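import Summits.BirchSwinnertonDyer.Rank1Residual.Partition.Bsdp
import Summits.BirchSwinnertonDyer.Rank1Residual.X2.RankZero
import Literature.NumberTheory.EllipticCurves.Rank1Residual.Typed.X11
import HarnessLib

/-!
# Class X11a (odd multiplicative `p`, irreducible `E[p]`, analytic rank `0`, no (ram) prime): the
# statement of record, its sub-cells, the closed sub-cell, and the typed missing input
# (cell `b2b-bsdres`, unit `b2b-bsdres-x11a`, gen 13)

HONEST FRAMING (run/shared/lean/b2b/bsd-rank1-residual/, verbatim in every file): the goal of the
cell is to DELETE the COMBINATION-SHAPED residual classes of the Birch–Swinnerton-Dyer formula for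
ALL analytic-rank `≤ 1` elliptic curves over `ℚ` — "full BSD formula for every rank `≤ 1` curve in
class `C`" assembled STRICTLY from published theorems — so that the rank-`≤ 1` remainder becomes
exactly the CONSTRUCTION-SHAPED classes, which are TYPED (missing-input `Prop`s), NOT attempted.
This is not "finishing BSD". CLASS-OWNERS.md (2026-08-19): research routes; NO CLAIM BEYOND STATED
CLASSES. This is the STATEMENT FILE of row X11a ("Lean STATEMENTS FIRST under
`Summits/BirchSwinnertonDyer/Rank1Residual/<Class>/`"); it asserts NOTHING: definitions (sub-cells,
targets) and bookkeeping theorems over decls already in the tree.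

**The class** (PARTITION lemma, statement of record = `Summits/…/Rank1Residual/Partition/Rows.lean`,
RESIDUAL-CASES.md §a.2 v5 row X11a, verbatim):
`ClassX11a W p := W.analyticRank = 0 ∧ p ≠ 2 ∧ Mult W p ∧ Irr W p ∧ ¬ Ram W p` — an odd prime
`p ‖ N` with `E[p]` irreducible and NO second multiplicative prime `q ≠ p` at which `E[p]` is
ramified (`Ram W p := ∃ q ‖ N, q ≠ p, p ∤ v_q(Δ_min)`), analytic rank `0`. Its complement inside
{`r = 0`, `p ≥ 3`, mult, irr} is the COVERED row C1 (Skinner, Pacific J. Math. 283 (2016) Thm. C,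
`RowC1`; `rowC1_or_classX11a`). Label at input: COMBINATION-SHAPED (class level), every census
pair closed per pair (below).

**Sub-cells** (a decidable case split on the data `p`, `surj(p)`, `ord_p #Ш_an`; exhaustive and
pairwise disjoint: `cellThree_or_cellPub_or_leaf`, `cells_disjoint`):
* `CellThree W p := ClassX11a W p ∧ p = 3` — the `p = 3` clause; owner x11b/x11c
  (`Literature/…/Rank1Residual/Typed/X11Three.lean`, typed input `X11ThreeRankZero.MissingInputAt`,
  = `X11RankZero.MissingInputAt W 3` definitionally, `X11RankZero.missingInputAt_three_iff`).
* `CellPub W p := ClassX11a W p ∧ 5 ≤ p ∧ Surj W p ∧ ShaAnUnit W p` — **CLOSED from print**: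
  Wuthrich, Doc. Math. 19 (2014) Prop. 21 (`ord_p #Ш ≤ ord_p #Ш_an` for `ρ̄` surjective at a
  non-additive odd `p`) + Gross–Zagier–Kolyvagin + modularity ⇒ `BSD(E,p)`
  (`targetPub_of_published` ← x11a gen 1 `Rank1Residual.bsdp_of_classX11_rankZero_surj_of_shaAn_unit`).
* `Leaf W p := ClassX11a W p ∧ 5 ≤ p ∧ ¬ (Surj W p ∧ ShaAnUnit W p)` — the residue: `p ≥ 5` and
  (`ρ̄_{E,p}` not surjective, or `p ∣ #Ш(E/ℚ)_an`). Split further as `Leaf ∧ Surj` (then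
  `p ∣ #Ш_an`; the upper bound is in print and the missing input is the LOWER bound
  `ord_p #Ш_an ≤ ord_p #Ш`, companion file `bsdp_iff_missingLowerBoundAt_of_surj`) and `Leaf ∧ ¬Surj`
  (irreducible non-surjective image at `p ≥ 5` with `p ‖ N`: the whole `p`-part is missing; no
  census pair).

**The typed missing input** of the leaf is Mazur's cyclotomic main conjecture at the multiplicative
prime `p` for `E` — the tree predicate `X2.MazurMainConjectureAt W p`
(`Summits/…/Rank1Residual/X2/Cells.lean`, eisenstein-p2: for every datum `(κ, γ, f, ϖ, D)`,
`X(E/ℚ_∞)` is `Λ`-torsion, `char_Λ X = (g)`, `ι(T^e·g·w) = ϖ·L_p` with `w ∈ Λˣ`, `e = 1` split /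
`0` non-split — verbatim the CONCLUSION of Skinner 2016 Thm. A, whose printed hypothesis (iii) is
(ram)). It is class-agnostic (no image hypothesis), so it is NOT re-declared here:
`bsdp_of_mazurMainConjectureAt` (= eisenstein-p2's `X2.bsdp_of_mazurMainConjectureAt_of_analyticRank_eq_zero`
on X11a: main conjecture at the pair + Stein–Wuthrich 2013 Thm. 6.1 + Greenberg–Stevens + GZK +
modularity ⇒ `BSD(E,p)`), `targetLeaf_of_forall_mazurMainConjectureAt`,
`target_of_published_of_missingInputs`. The companion file `X11a/MainConjecture.lean` proves the
CONVERSE on `Leaf ∧ Surj` (Kato's divisibility for surjective `ρ_{E,p^∞}` at `p ‖ N` + the same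
leading-term facts: `BSD(E,p)` ⇒ the main conjecture at the pair), so that on the surjective leaf
the missing input is EXACTLY Mazur's main conjecture at a (ram)-free multiplicative prime — neither
weaker nor stronger — and every per-pair certificate of `BSD(E,p)` is a per-pair PROOF of that main
conjecture. Consistency with the gen-2 typing (`X11RankZero.MissingInputAt` of `Typed/X11.lean` is exact on X11a) and
the lower-bound form on the surjective leaf are in the companion file.

**Where print stops** (located gap; REPORT-g1…g12 of the unit, FRESHNESS.md X11 rows): the
lower bound at a (ram)-free multiplicative prime = the Eisenstein-congruence direction of the
cyclotomic main conjecture at `p ‖ N`. Skinner 2016 Thm. A/C and Skinner–Urban 2014 need (ram);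
Burungale–Castella–Skinner 2025 remove it only at GOOD ordinary `p`; Fouquet–Wan keep (Steinberg)
= (ram); the Emerton–Pollack–Weston transfer (`Typed/X11HidaTransfer.lean`) needs a congruent partner
with a known identity, in print (BCS ∘ Ribet) only for `E[p]` peu ramifié and then a `GL₂`-type
form. PER PAIR the leaf is reached by PUBLISHED theorem + certificate, all in the tree: Kim 2026
Thm. 1.8 (6) + one unit Kurihara number (`X11RankZero.bsdp_of_kim_of_kuriharaNumber_ne_zero`, gen 12;
hook in `X11a/MainConjecture.lean`), congruence visibility (`X11RankZero.bsdp_of_congr_of_rank_two`,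
gen 9), EPW transfer (`X11RankZero.bsdp_of_transfer_*`, gen 8).

**Census** (unit reports, lane to certify; collector 2026-08-18, `N < 2·10⁴`, X11-type `p ≥ 5`,
`r = 0`): 615 pairs, all `¬ram`, all `ρ̄` surjective; 613 in `CellPub`; 2 on the leaf
(`10580l1@5`, `17640l1@5`, `#Ш_an = 25`), both closed per pair by visibility AND by Kim certificates
(REPORT-g9, g12). Extended leaf list `N < 5·10⁵` (`p ∣ #Ш_an`, 158 pairs): 148 closed per pair
(108 visibility ∪ 143 Kim, 138 two-engine), 10 open PER PAIR ONLY (6 with `p ∣ ∏ c_ℓ`: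
`285660u1/u2, 320045bh1, 375440db1, 419120cq1, 490960cp1 @5`; 4 beyond every engine:
`206856cb1@17, 244068m1@11, 429975cr1@13, 285660k1@5`). `Leaf ∧ ¬Surj`: no census pair.

References: RESIDUAL-CASES.md §a.2 rows X11/X11a; PARTITION.md; `b2b-bsdres-x11a/REPORT*.md`;
C. Skinner, Pacific J. Math. 283 (2016) Thm. A, C [Skinner2016PacificMC]; C. Wuthrich, Doc. Math. 19
(2014) Prop. 21 [Wuthrich2014]; W. Stein, C. Wuthrich, Math. Comp. 82 (2013) Thm. 6.1
[SteinWuthrich2013]; R. Greenberg, G. Stevens, Invent. Math. 111 (1993) [GreenbergStevens1993];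
C.-H. Kim, Amer. J. Math. 148 (2026) Thm. 1.8 [Kim2022StructureSelmer]; A. Burungale, F. Castella,
C. Skinner, IMRN 2025 [BurungaleCastellaSkinner2025]; M. Emerton, R. Pollack, T. Weston, Invent.
Math. 163 (2006) [EmertonPollackWeston2006]; R. L. Miller, LMS J. Comput. Math. 14 (2011) Def. 1.1,
Thm. 1.2 [Miller2011LMS].
-/

set_option autoImplicit false

noncomputable section

open scoped Classical MatrixGroups ModularForm

open CongruenceSubgroup WeierstrassCurve Literature.NumberTheory.EllipticCurves
  Literature.NumberTheory.EllipticCurves.ModularForms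
  Literature.NumberTheory.EllipticCurves.Rank1Residual
  Literature.NumberTheory.EllipticCurves.Rank1Residual.Typed
  Literature.NumberTheory.EllipticCurves.Wuthrich2014
  Literature.NumberTheory.EllipticCurves.SteinWuthrich2013

namespace Summit.BirchSwinnertonDyer.Rank1Residual.X11a

/-! ### The statement of record -/

/-- **Class theorem of record for X11a** (OPEN at class level; research route, no claim): for every
elliptic curve `E/ℚ` (globally minimal model `W`) with `ord_{s=1} L(E,s) ≤ 1` and every prime `p`
with `(E,p) ∈ X11a` (`r = 0`, `p` odd, `p ‖ N`, `E[p]` irreducible, no (ram) prime), Miller's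
`BSD(E,p)`. The rank hypothesis is implied by the class (`r = 0`) and kept for uniformity with the
other class files. A `Prop`; nothing asserted. [folklore] -/
def Target : Prop :=
  ∀ (W : WeierstrassCurve ℚ) [W.IsElliptic] [W.IsGloballyMinimal] (p : ℕ) [Fact p.Prime],
    W.analyticRank ≤ 1 → ClassX11a W p → BSDp W p

/-! ### The sub-cells -/

section Cells

variable (W : WeierstrassCurve ℚ) [W.IsElliptic] [W.IsGloballyMinimal] (p : ℕ) [Fact p.Prime]

omit [W.IsElliptic] [W.IsGloballyMinimal] [Fact p.Prime] in
/-- `#Ш(E/ℚ)_an` is a rational number of `p`-adic valuation `0` (the census bit "`p ∤ #Ш_an`" in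
the shape consumed by `Rank1Residual.bsdp_of_classX11_rankZero_surj_of_shaAn_unit`).
[cite: Miller2011LMS, Def. 1.1 (arXiv:1010.2431 p. 3) (shape only; nothing asserted)] -/
def ShaAnUnit : Prop := ∃ q : ℚ, shaAn W = (q : ℂ) ∧ padicValRat p q = 0

/-- **Sub-cell `p = 3`** of X11a: the `p = 3` clause (owner x11b/x11c, `Typed/X11Three.lean`).
[folklore] -/
def CellThree : Prop := ClassX11a W p ∧ p = 3

/-- **The PUBLISHED sub-cell** of X11a: `p ≥ 5`, `ρ̄_{E,p}` surjective, `p ∤ #Ш(E/ℚ)_an` —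
closed by Wuthrich 2014 Prop. 21 (`targetPub_of_published`). [folklore] -/
def CellPub : Prop := ClassX11a W p ∧ 5 ≤ p ∧ Surj W p ∧ ShaAnUnit W p

/-- **The leaf (residue) of X11a**: `p ≥ 5` and NOT (surjective ∧ `p ∤ #Ш_an`), i.e. `ρ̄_{E,p}`
not surjective or `p ∣ #Ш(E/ℚ)_an`. Typed missing input: Mazur's main conjecture at the pair
(`X2.MazurMainConjectureAt W p`). [folklore] -/
def Leaf : Prop := ClassX11a W p ∧ 5 ≤ p ∧ ¬ (Surj W p ∧ ShaAnUnit W p)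

omit [W.IsElliptic] in
/-- The three sub-cells exhaust X11a (an odd prime is `3` or `≥ 5`; excluded middle on the
published sub-cell's datum). [folklore] -/
theorem cellThree_or_cellPub_or_leaf (hX : ClassX11a W p) :
    CellThree W p ∨ CellPub W p ∨ Leaf W p := by
  have hpP : p.Prime := Fact.out
  have hp2 : p ≠ 2 := hX.2.1
  by_cases h3 : p = 3
  · exact Or.inl ⟨hX, h3⟩
  · have h5 : 5 ≤ p := by
      have h2le := hpP.two_le
      have h4 : p ≠ 4 := fun h => by
        rw [h] at hpP
        exact absurd hpP (by decide)
      omega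
    by_cases hpub : Surj W p ∧ ShaAnUnit W p
    · exact Or.inr (Or.inl ⟨hX, h5, hpub.1, hpub.2⟩)
    · exact Or.inr (Or.inr ⟨hX, h5, hpub⟩)

omit [W.IsElliptic] in
/-- The sub-cells are pairwise disjoint (bookkeeping). [folklore] -/
theorem cells_disjoint :
    ¬ (CellThree W p ∧ CellPub W p) ∧ ¬ (CellThree W p ∧ Leaf W p) ∧ ¬ (CellPub W p ∧ Leaf W p) := by
  refine ⟨fun ⟨h3, hP⟩ => ?_, fun ⟨h3, hL⟩ => ?_, fun ⟨hP, hL⟩ => hL.2.2 ⟨hP.2.2.1, hP.2.2.2⟩⟩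
  · have := hP.2.1; have := h3.2; omega
  · have := hL.2.1; have := h3.2; omega

end Cells

variable {W : WeierstrassCurve ℚ} [W.IsElliptic] [W.IsGloballyMinimal] {p : ℕ} [Fact p.Prime]

/-! ### Atoms of the class and of the leaf -/

omit [W.IsElliptic] in
/-- An X11a pair has analytic rank `0`. [folklore] -/
theorem _root_.Summit.BirchSwinnertonDyer.Rank1Residual.ClassX11a.analyticRank_eq_zero
    (h : ClassX11a W p) : W.analyticRank = 0 := h.1

omit [W.IsElliptic] in
/-- An X11a pair has `p` odd. [folklore] -/
theorem _root_.Summit.BirchSwinnertonDyer.Rank1Residual.ClassX11a.ne_two (h : ClassX11a W p) :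
    p ≠ 2 := h.2.1

omit [W.IsElliptic] in
/-- An X11a pair has multiplicative reduction at `p`. [folklore] -/
theorem _root_.Summit.BirchSwinnertonDyer.Rank1Residual.ClassX11a.mult (h : ClassX11a W p) :
    Mult W p := h.2.2.1

omit [W.IsElliptic] in
/-- An X11a pair has `E[p]` irreducible. [folklore] -/
theorem _root_.Summit.BirchSwinnertonDyer.Rank1Residual.ClassX11a.irr (h : ClassX11a W p) :
    Irr W p := h.2.2.2.1

omit [W.IsElliptic] in
/-- An X11a pair has NO (ram) witness. [folklore] -/
theorem _root_.Summit.BirchSwinnertonDyer.Rank1Residual.ClassX11a.not_ram (h : ClassX11a W p) :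
    ¬ Ram W p := h.2.2.2.2

/-- At an X11a pair `L(E,1) ≠ 0` (modularity `hmod`: `r_an = 0 ⇔ L(E,1) ≠ 0`).
[cite: BreuilConradDiamondTaylor2001, Thm. A] -/
theorem _root_.Summit.BirchSwinnertonDyer.Rank1Residual.ClassX11a.L_one_ne_zero
    (hmod : hasEntireLFunction_rat) (h : ClassX11a W p) : W.entireLFunction 1 ≠ 0 :=
  (W.analyticRank_eq_zero_iff_holds (hmod W)).mp h.1

omit [W.IsElliptic] in
/-- Constructor: a rank-`0` pair at an odd multiplicative irreducible prime without (ram) is in X11a.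
[folklore] -/
theorem classX11a_of (hr : W.analyticRank = 0) (hp : p ≠ 2) (hmult : Mult W p) (hirr : Irr W p)
    (hnram : ¬ Ram W p) : ClassX11a W p := ⟨hr, hp, hmult, hirr, hnram⟩

omit [W.IsElliptic] in
/-- A leaf pair is an X11a pair. [folklore] -/
theorem Leaf.classX11a (h : Leaf W p) : ClassX11a W p := h.1

omit [W.IsElliptic] in
/-- A leaf pair has `p ≥ 5`. [folklore] -/
theorem Leaf.five_le (h : Leaf W p) : 5 ≤ p := h.2.1

omit [W.IsElliptic] in
/-- On the leaf, a surjective `ρ̄_{E,p}` forces `p ∣ #Ш(E/ℚ)_an` (in the shape: `#Ш_an` is NOT a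
rational `p`-adic unit). [folklore] -/
theorem Leaf.not_shaAnUnit_of_surj (h : Leaf W p) (hsurj : Surj W p) : ¬ ShaAnUnit W p :=
  fun hu => h.2.2 ⟨hsurj, hu⟩

omit [W.IsElliptic] in
/-- The leaf in disjunctive form: `ρ̄_{E,p}` not surjective, or `#Ш_an` not a `p`-adic unit.
[folklore] -/
theorem leaf_iff : Leaf W p ↔ ClassX11a W p ∧ 5 ≤ p ∧ (¬ Surj W p ∨ ¬ ShaAnUnit W p) := by
  simp only [Leaf, not_and_or]

omit [W.IsElliptic] in
/-- A published-sub-cell pair is an X11a pair. [folklore] -/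
theorem CellPub.classX11a (h : CellPub W p) : ClassX11a W p := h.1

omit [W.IsElliptic] in
/-- A `p = 3` sub-cell pair is an X11 pair at `p = 3` of analytic rank `0` without (ram) — the
domain of x11b's `X11ThreeRankZero.MissingInputAt` (`Typed/X11Three.lean`). [folklore] -/
theorem CellThree.classX11_three (h : CellThree W p) :
    ClassX11 W p ∧ p = 3 ∧ W.analyticRank = 0 ∧ ¬ Ram W p :=
  ⟨h.1.toX11, h.2, h.1.1, h.1.not_ram⟩

/-! ### The covered neighbour: rank `0`, multiplicative, irreducible is C1 or X11a -/

omit [W.IsElliptic] in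
/-- **Dichotomy at a rank-`0` odd multiplicative irreducible prime `p ≥ 3`**: either (ram) holds —
covered row C1 (Skinner 2016 Thm. C, `RowC1`) — or the pair is in X11a. Pure logic on the
predicates. [cite: Skinner2016PacificMC, Thm. C (§1) (hypothesis (ii) = (ram))] -/
theorem rowC1_or_classX11a (hr : W.analyticRank = 0) (hp : 3 ≤ p) (hmult : Mult W p)
    (hirr : Irr W p) : RowC1 W p ∨ ClassX11a W p := by
  by_cases hram : Ram W p
  · exact Or.inl ⟨hr, hp, Or.inr hmult, hirr, hram⟩
  · exact Or.inr ⟨hr, by omega, hmult, hirr, hram⟩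

/-- **At a rank-`0` multiplicative irreducible prime `p ≥ 3`: `BSD(E,p)` from Skinner 2016 Thm. C
(named fact `hSk`, PUBLISHED) OR the pair is in X11a** (`RowC1.bsdp` of the partition lemma;
modularity `hmod`, Gross–Zagier–Kolyvagin `hGZK`). [cite: Skinner2016PacificMC, Thm. C (§1)] -/
theorem bsdp_or_classX11a (hSk : Skinner2016.thmC_padicValRat_bsd_rank_zero)
    (hmod : hasEntireLFunction_rat) (hGZK : rank_eq_analyticRank_of_analyticRank_le_one)
    (hr : W.analyticRank = 0) (hp : 3 ≤ p) (hmult : Mult W p) (hirr : Irr W p) :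
    BSDp W p ∨ ClassX11a W p :=
  (rowC1_or_classX11a hr hp hmult hirr).imp_left (RowC1.bsdp hSk hmod hGZK)

/-! ### Sub-cell targets and the assembly -/

/-- Target of the `p = 3` sub-cell (x11b/x11c's domain): `BSD(E,3)` on every `CellThree` pair.
A `Prop`; nothing asserted. [folklore] -/
def TargetThree : Prop :=
  ∀ (W : WeierstrassCurve ℚ) [W.IsElliptic] [W.IsGloballyMinimal] (p : ℕ) [Fact p.Prime],
    CellThree W p → BSDp W p

/-- Target of the published sub-cell: `BSD(E,p)` on every `CellPub` pair. PROVED from published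
named facts (`targetPub_of_published`). A `Prop`; nothing asserted. [folklore] -/
def TargetPub : Prop :=
  ∀ (W : WeierstrassCurve ℚ) [W.IsElliptic] [W.IsGloballyMinimal] (p : ℕ) [Fact p.Prime],
    CellPub W p → BSDp W p

/-- Target of the leaf (OPEN at class level; every census pair closed per pair): `BSD(E,p)` on
every `Leaf` pair. A `Prop`; nothing asserted. [folklore] -/
def TargetLeaf : Prop :=
  ∀ (W : WeierstrassCurve ℚ) [W.IsElliptic] [W.IsGloballyMinimal] (p : ℕ) [Fact p.Prime],
    Leaf W p → BSDp W p

/-- **Assembly / disassembly**: the class statement of record is the conjunction of the three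
sub-cell targets (pure logic; `r ≤ 1` is automatic on the class). [folklore] -/
theorem target_iff_targets : Target ↔ TargetThree ∧ TargetPub ∧ TargetLeaf := by
  constructor
  · intro h
    exact ⟨fun W _ _ p _ hc => h W p (by rw [hc.1.1]; exact zero_le_one) hc.1,
      fun W _ _ p _ hc => h W p (by rw [hc.1.1]; exact zero_le_one) hc.1,
      fun W _ _ p _ hc => h W p (by rw [hc.1.1]; exact zero_le_one) hc.1⟩
  · rintro ⟨h3, hP, hL⟩ W _ _ p _ - hX
    rcases cellThree_or_cellPub_or_leaf W p hX with h | h | h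
    · exact h3 W p h
    · exact hP W p h
    · exact hL W p h

/-! ### The published sub-cell is closed -/

/-- **`CellPub` ⇒ `BSD(E,p)` from PUBLISHED theorems**: Wuthrich, Doc. Math. 19 (2014) Prop. 21
(named fact `hWu = Wuthrich2014.sha_dvd_analyticSha`: `#Ш ∣ C·(L(E,1)/Ω)·#E(ℚ)²/∏c_v`, `p ∤ C` at a
non-additive odd `p` with `ρ̄` surjective) gives `0 ≤ ord_p #Ш ≤ ord_p #Ш_an = 0`; modularity
(`hmod`) reads `r = 0` as `L(E,1) ≠ 0`; Gross–Zagier–Kolyvagin (`hGZK`) gives `rank = 0`, `Ш`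
finite. By name: x11a gen 1 `Rank1Residual.bsdp_of_classX11_rankZero_surj_of_shaAn_unit`.
[cite: Wuthrich2014, Prop. 21 (p. 400)] -/
theorem CellPub.bsdp (hWu : sha_dvd_analyticSha) (hGZK : rank_eq_analyticRank_of_analyticRank_le_one)
    (hmod : hasEntireLFunction_rat) (h : CellPub W p) : BSDp W p :=
  bsdp_of_classX11_rankZero_surj_of_shaAn_unit W p hWu hGZK h.1.ne_two h.1.toX11
    (h.1.L_one_ne_zero hmod) h.2.2.1 h.2.2.2

/-- **The published sub-cell target holds** (Wuthrich Prop. 21 `hWu`, GZK `hGZK`, modularity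
`hmod`). [cite: Wuthrich2014, Prop. 21 (p. 400)] -/
theorem targetPub_of_published (hWu : sha_dvd_analyticSha)
    (hGZK : rank_eq_analyticRank_of_analyticRank_le_one) (hmod : hasEntireLFunction_rat) :
    TargetPub :=
  fun _ _ _ _ _ hc => hc.bsdp hWu hGZK hmod

/-- Hence the class statement of record reduces to the `p = 3` sub-cell and the leaf (same facts).
[cite: Wuthrich2014, Prop. 21 (p. 400)] -/
theorem target_iff_targetThree_and_targetLeaf (hWu : sha_dvd_analyticSha)
    (hGZK : rank_eq_analyticRank_of_analyticRank_le_one) (hmod : hasEntireLFunction_rat) :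
    Target ↔ TargetThree ∧ TargetLeaf := by
  rw [target_iff_targets]
  exact ⟨fun h => ⟨h.1, h.2.2⟩, fun h => ⟨h.1, targetPub_of_published hWu hGZK hmod, h.2⟩⟩

/-! ### The finite sub-class `N_E < 5000` (Miller 2011) cuts across the cells -/

/-- **X11a ∧ `N_E < 5000` ⇒ `BSD(E,p)`** — Miller, LMS J. Comput. Math. 14 (2011) Thm. 1.2 (with
Lawson–Wuthrich 2016 §5) as the named fact `hM = bsdp_of_irreducible_of_conductor_lt`; by name
`Rank1Residual.bsdp_of_classX11_of_conductor_lt`. A finite sub-class, not a class theorem.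
[cite: Miller2011LMS, Thm. 1.2] -/
theorem bsdp_of_conductor_lt (hM : bsdp_of_irreducible_of_conductor_lt) (hX : ClassX11a W p)
    (hN : W.conductorNorm ℤ < 5000) : BSDp W p :=
  bsdp_of_classX11_of_conductor_lt W p hM (by rw [hX.1]; exact zero_le_one) hX.toX11 hN

/-! ### The typed missing input of the leaf: Mazur's main conjecture at the multiplicative prime -/

/-- **X11a: Mazur's main conjecture at `(E,p)` ⇒ `BSD(E,p)`** (any odd multiplicative `p`, any
image). The typed input is eisenstein-p2's class-agnostic `X2.MazurMainConjectureAt W p` (the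
conclusion shape of Skinner 2016 Thm. A: `char_Λ X(E/ℚ_∞) = (g)`, `ι(T^e·g·w) = ϖ·L_p`); the glue is
`X2.bsdp_of_mazurMainConjectureAt_of_analyticRank_eq_zero` (x11a gen 8 rank-`0` glue
`Typed.bsdp_of_multCharIdeal_{split,nonsplit}_rankZero` with every datum instantiated from tree
theorems). PUBLISHED named facts: Stein–Wuthrich 2013 Thm. 6.1 (`hJs`/`hJn`) with the existence of
THE §4.2 heights (`hHs`/`hHn`), Greenberg–Stevens (`hGS`), Gross–Zagier–Kolyvagin (`hGZK`),
modularity (`hmod`, `hpar`); tree theorem `𝓛_p ≠ 0`. [cite: SteinWuthrich2013, Thm. 6.1 (p. 20) and §4.2]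
[cite: Skinner2016PacificMC, Thm. A (§1), §3.2–3.3 (shape)] [cite: Miller2011LMS, Def. 1.1 and §1] -/
theorem bsdp_of_mazurMainConjectureAt
    (hJs : thm61_splitMultiplicative) (hJn : thm61_nonsplitMultiplicative)
    (hHs : exists_isSplitMultCanonical) (hHn : exists_isMultCanonical)
    (hGZK : rank_eq_analyticRank_of_analyticRank_le_one) (hmod : hasEntireLFunction_rat)
    (hpar : nonempty_modularParametrizationData)
    (hGS : greenberg_stevens (W := W) (p := p))
    (hX : ClassX11a W p) (hMC : X2.MazurMainConjectureAt W p) : BSDp W p :=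
  X2.bsdp_of_mazurMainConjectureAt_of_analyticRank_eq_zero hJs hJn hHs hHn hGZK hmod hpar W p hGS
    hX.ne_two hX.mult hX.1 hMC

/-- **The leaf target from its typed missing input**: Mazur's main conjecture at every leaf pair
(OPEN; nothing in print or announced at a (ram)-free multiplicative prime) + the published rank-`0`
inputs ⇒ `TargetLeaf`. [cite: SteinWuthrich2013, Thm. 6.1 (p. 20)] [cite: Miller2011LMS, Def. 1.1 and §1] -/
theorem targetLeaf_of_forall_mazurMainConjectureAt
    (hJs : thm61_splitMultiplicative) (hJn : thm61_nonsplitMultiplicative)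
    (hHs : exists_isSplitMultCanonical) (hHn : exists_isMultCanonical)
    (hGZK : rank_eq_analyticRank_of_analyticRank_le_one) (hmod : hasEntireLFunction_rat)
    (hpar : nonempty_modularParametrizationData)
    (hGS : ∀ (W : WeierstrassCurve ℚ) [W.IsElliptic] [W.IsGloballyMinimal] (p : ℕ) [Fact p.Prime],
      greenberg_stevens (W := W) (p := p))
    (hMC : ∀ (W : WeierstrassCurve ℚ) [W.IsElliptic] [W.IsGloballyMinimal] (p : ℕ) [Fact p.Prime],
      Leaf W p → X2.MazurMainConjectureAt W p) :
    TargetLeaf :=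
  fun W _ _ p _ hL =>
    bsdp_of_mazurMainConjectureAt hJs hJn hHs hHn hGZK hmod hpar (hGS W p) hL.1 (hMC W p hL)

/-- **The class statement of record from the published facts, the `p = 3` sub-cell target
(x11b/x11c) and the leaf's typed input** (Mazur's main conjecture at every leaf pair): the exact
shape of what remains of X11a after this file — the published sub-cell needs nothing further.
[cite: Wuthrich2014, Prop. 21 (p. 400)] [cite: SteinWuthrich2013, Thm. 6.1 (p. 20)]
[cite: Miller2011LMS, Def. 1.1 and §1] -/
theorem target_of_published_of_missingInputs (hWu : sha_dvd_analyticSha)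
    (hJs : thm61_splitMultiplicative) (hJn : thm61_nonsplitMultiplicative)
    (hHs : exists_isSplitMultCanonical) (hHn : exists_isMultCanonical)
    (hGZK : rank_eq_analyticRank_of_analyticRank_le_one) (hmod : hasEntireLFunction_rat)
    (hpar : nonempty_modularParametrizationData)
    (hGS : ∀ (W : WeierstrassCurve ℚ) [W.IsElliptic] [W.IsGloballyMinimal] (p : ℕ) [Fact p.Prime],
      greenberg_stevens (W := W) (p := p))
    (h3 : TargetThree)
    (hMC : ∀ (W : WeierstrassCurve ℚ) [W.IsElliptic] [W.IsGloballyMinimal] (p : ℕ) [Fact p.Prime],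
      Leaf W p → X2.MazurMainConjectureAt W p) :
    Target :=
  (target_iff_targetThree_and_targetLeaf hWu hGZK hmod).mpr
    ⟨h3, targetLeaf_of_forall_mazurMainConjectureAt hJs hJn hHs hHn hGZK hmod hpar hGS hMC⟩

end Summit.BirchSwinnertonDyer.Rank1Residual.X11a

end
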